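import Summits.AtomisticToContinuum.FouriersLaw.Theorems.BoundedResponseConverges.Negative.OscillationExcluded
import Summits.AtomisticToContinuum.FouriersLaw.Theorems.JunctionLocalitySuperadditiveResistanceStubLinearResponsePlain
import Summits.AtomisticToContinuum.FouriersLaw.Theses.TransferKernelPositivity

/-!
# `BoundedResponseConverges` (crux stmt-AtomisticToContinuum-9141) from the two junction-locality cruxes, BY NAME

Helper file (`--supports stmt-AtomisticToContinuum-9141`, lead seat c2). The disprover's landed kill criterion
`boundedResponseConverges_iff_noBoundedInsulator` (`Negative/OscillationExcluded`) says: granted route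
`JunctionLocality`'s bet (A) `SuperadditiveResistance` (stmt-AtomisticToContinuum-11748: `R_N + R_M − C ≤ R_{N+M}`)
and fixed-`N` positivity (P) `PositiveConductance` (stmt-11750), the crux is equivalent to "no bounded-response
perfect insulator". Since 2026-08-16 (P) is a THEOREM (`ThermaliseThenCutProbeInsertion.positiveConductance_proof`)
and the insulator is excluded by name by the crux `ConductanceLowerBound` (stmt-11749: `∃ c > 0, c ≤ D_N` eventually).
Hence the by-name reduction recorded here:

* `boundedResponseConverges_of_superadditiveResistance_of_conductanceLowerBound` —
  **`SuperadditiveResistance → ConductanceLowerBound → BoundedResponseConverges`**: the crux of this line closes the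
  moment the two open cruxes of route `JunctionLocality` (both with staffed crux chains, `Cruxes/SuperadditiveResistance/`,
  `Cruxes/ConductanceLowerBound/`) land — a second supply line beside `FeketeSeriesLaw.QuasiSubadditiveResistance`
  (stmt-14041, `boundedResponseConverges_of_quasiSubadditiveResistance`, p97434) and beside this line's own lever
  (`boundedResponseConverges_of_kuboLadderUp`).

Pure bookkeeping over landed theorems; no definitions, no named facts; standard axioms.
-/

noncomputable section

namespace Summit.AtomisticToContinuum.FouriersLaw.Theorems

open MeasureTheory Filter Topology
open Summit.AtomisticToContinuum.FouriersLaw.Theses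

/-- **The two junction-locality cruxes close `BoundedResponseConverges`.** Under (A)
`JunctionLocality.SuperadditiveResistance` (stmt-11748) every bounded response sequence of the pinned anharmonic chain
converges, to `0` or to some `k > 0` (`boundedResponseConverges_response_tendsto_zero_or_pos`, with the positivity
hypothesis discharged by the landed `positiveConductance_proof`); `JunctionLocality.ConductanceLowerBound` (stmt-11749)
excludes the limit `0`. [folklore] -/
theorem boundedResponseConverges_of_superadditiveResistance_of_conductanceLowerBound :
    Summit.AtomisticToContinuum.FouriersLaw.Theses.JunctionLocality.SuperadditiveResistance →
      Summit.AtomisticToContinuum.FouriersLaw.Theses.JunctionLocality.ConductanceLowerBound →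
        Summit.AtomisticToContinuum.FouriersLaw.Theses.OddSectorIrreversibility.BoundedResponseConverges := by
  intro hA hF ω₂ lam β γ hω hl hβ hγ hu μ hμ T hT D hD hB
  have hP : JunctionLocality.PositiveConductance :=
    Summit.AtomisticToContinuum.FouriersLaw.Cruxes.SuperadditiveResistance.ThermaliseThenCutProbeInsertion.positiveConductance_proof
  rcases boundedResponseConverges_response_tendsto_zero_or_pos hA hP hω hl hβ hγ hu hμ hT hD hB with h0 | hk
  · -- the floor excludes the insulator
    obtain ⟨c, hc, N₁, hfloor⟩ := hF ω₂ lam β γ hω hl hβ hγ hu μ hμ T hT D hD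
    have hle : c ≤ 0 := ge_of_tendsto h0 (eventually_atTop.2 ⟨N₁, hfloor⟩)
    exact absurd hle (not_le.2 hc)
  · exact hk

/-- The same reduction for the verbatim twin `JunctionLocality`-side reading: route `JunctionLocality`'s own glue
expects `SuperadditiveResistance`, `PositiveConductance`, `ConductanceLowerBound`; with positivity landed, the two
cruxes suffice for the shared import slot. (Corollary, stated for the `TransferKernelPositivity` twin, which is the
crux definitionally.) [folklore] -/
theorem boundedResponseConverges_transferKernelPositivity_of_junctionLocality
    (hA : JunctionLocality.SuperadditiveResistance) (hF : JunctionLocality.ConductanceLowerBound) :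
    TransferKernelPositivity.BoundedResponseConverges :=
  boundedResponseConverges_of_superadditiveResistance_of_conductanceLowerBound hA hF

end Summit.AtomisticToContinuum.FouriersLaw.Theorems

end
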